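import Mathlib
import Summits.ValiantsHypothesis.ValiantsHypothesis.Theorems.BarrierLeverDefinableEquationsSparsityWallSharp
import Summits.ValiantsHypothesis.ValiantsHypothesis.Theorems.BarrierLeverDefinableEquationsDegreeWindow
import HarnessLib

/-!
# Crux `BarrierLever.DefinableEquations` (stmt-8745) ⟺ `SingleSizeEquations` (stmt-8749) —
# the SPARSITY WALL IN A DEGREE WINDOW: an equation for size `s` living on the degree-`≤ d`
# coefficients has `≥ 2^{(s - 2n - 1)/(d+1) + 1}` monomials; at the open rung `b = 2` a
# degree-`d` window equation has `≥ 2^{(n² - 2n - 1)/(d+1) + 1}` monomials — MORE than `N^a`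
# as soon as `n ≥ 2a(d+1) + 3` (val-np-p5 g22)

The degree-window door (`…DegreeWindow.lean`) asks for a level-`a` Boolean-sum equation in the
`C(n+d-1,d)` degree-`d` coefficient variables alone, `d` fixed.  This file says how such a witness
CANNOT look: it is never sparse.  The halving recursion of the cell's sparsity wall
(`…SparsityWall.lean`, `…SparsityWallSharp.lean`, val-np-p5 g8/g12: a non-monomial equation splits
along a coordinate `μ` into a TOP piece `∂_μ^{deg_μ} E` and a BOTTOM piece `(∂_μ^{j_min} E)(c_μ:=0)`,
both nonzero equations for the class one rung of size below, with disjointly embedded monomials)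
charges one rung = the cost `|μ| + 1` of a translate `f + t·x^μ`; for an equation all of whose
coordinates have degree `≤ d` every rung costs only `d + 1` (instead of `n + 1`), and the pieces
again live on degree-`≤ d` coordinates.  Hence:

* §1–§3 translation at cost `d + 1`, the two pieces one `(d+1)`-rung down, and the invariant
  "all monomials of `E` involve only coordinates of degree `≤ d`" (preserved by both pieces; the
  splitting coordinate has degree `≤ d`).
* §4 `card_support_ge_two_pow_deg` — a nonzero polynomial in the `N = C(2n,n)` coefficient
  variables involving only degree-`≤ d` coordinates and vanishing at `coeff(g)` for every `g` of
  degree `≤ n` and size `≤ s`, `2n + 1 + r(d+1) ≤ s`, has `≥ 2^(r+1)` monomials (the tree's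
  `card_support_ge_two_pow_sharp` is the case `d = n`).
* §5 WINDOW FORMS: `card_support_ge_two_pow_window` (equations in the degree-`d` window variables
  `GKSS2017.homMonomials n d`, pulled back), `cubicWindow_card_support_two` (at `b = 2`, `d = 3`,
  `n ≥ 3`: `≥ 2^((n²-2n-1)/4 + 1)` monomials — super-polynomial in `N ≤ 4^n`), and
  `pow_lt_card_support_window_two`: for `n ≥ 2a(d+1) + 3` EVERY nonzero degree-`d` window equation
  for `SmallCircuits ℂ n 2` has MORE than `N^a` monomials (explicit threshold; the full-space wall
  `…SparsityWallTwo` gives `> N^a` eventually by FSV's shift + batching, the window version is the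
  bare halving count).

READING (honest).  A window witness of the crux at `b = 2` is a polynomial of circuit size
`2^{O(n)}` with `2^{Ω(n²/d)}` monomials: compression by circuits is of the essence, depth-2 (`ΣΠ`)
presentations are excluded with room to spare.  WHAT THIS IS NOT: no verdict (b = 2 OPEN,
Chatterjee–Tengse 2023 §1.3 dir. 2); Boolean sums of size `N^a` can have `2^{N^a}` monomials, so
succinct witnesses are untouched; nothing on crux 14610 or `VP ≠ VNP`, which is NOT proved.
Route-independent.  No definitions, no named facts; standard axioms.

References: Bürgisser 2000 §2.1 (cost model); Forbes–Shpilka–Volk 2018, Def. 1 / Cor. 34;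
Guo–Kumar–Saptharishi–Solomon 2019 §3 (Taylor coefficients; tree `GKSS2019.*`).
-/

set_option linter.dupNamespace false

noncomputable section

namespace Summit.ValiantsHypothesis.ValiantsHypothesis.Theorems.BarrierLeverDefinableEquations

open MvPolynomial
open Literature.Computability.AlgebraicComplexity Literature.Barriers.ValiantsHypothesis
open scoped BigOperators

namespace DegreeWindow

open SparsityWall

/-! ## §1 Translation along a coordinate of degree `≤ d` costs `d + 1` -/

/-- Adding a scaled monomial `t·x^μ` with `|μ| ≤ d` (`≤ n`) to `f` keeps the degree `≤ n` and costs
at most `d + 1` gates (`L(t·x^μ) ≤ |μ|`). [cite: Burgisser2000, §2.1] -/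
theorem translate_mem_deg {n s d : ℕ} {f : MvPolynomial (Fin n) ℂ} (hf : f.totalDegree ≤ n)
    (hL : complexity f ≤ s) (μ : ↥(degLEMonomials n)) (hμ : (μ : Fin n →₀ ℕ).degree ≤ d) (t : ℂ) :
    (f + monomial (μ : Fin n →₀ ℕ) t).totalDegree ≤ n ∧
      complexity (f + monomial (μ : Fin n →₀ ℕ) t) ≤ s + (d + 1) := by
  have hμn : (μ : Fin n →₀ ℕ).degree ≤ n := μ.2
  refine ⟨(totalDegree_add _ _).trans (max_le hf ?_), ?_⟩
  · refine (totalDegree_monomial_le _ _).trans ?_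
    rwa [Finsupp.degree_apply] at hμn
  · have hm := complexity_monomial_le_degree (μ : Fin n →₀ ℕ) t
    have ha := complexity_add_le_holds f (monomial (μ : Fin n →₀ ℕ) t : MvPolynomial (Fin n) ℂ)
    omega

/-! ## §2 Both pieces are equations one `(d+1)`-rung down -/

/-- The line through `coeff(f)` in a direction `e_μ` of degree `≤ d` lies in the zero set of an
equation for size `s + d + 1` whenever `L(f) ≤ s`. [folklore] -/
theorem line_subset_zeros_deg {n s d : ℕ} {E : MvPolynomial ↥(degLEMonomials n) ℂ}
    (hE : ∀ g : MvPolynomial (Fin n) ℂ, g.totalDegree ≤ n → complexity g ≤ s + (d + 1) →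
      eval (coeffVector (degLEMonomials n) g) E = 0)
    {f : MvPolynomial (Fin n) ℂ} (hf : f.totalDegree ≤ n) (hL : complexity f ≤ s)
    (μ : ↥(degLEMonomials n)) (hμ : (μ : Fin n →₀ ℕ).degree ≤ d) (t : ℂ) :
    eval (fun ν => coeffVector (degLEMonomials n) f ν + if ν = μ then t else 0) E = 0 := by
  have h := (funext (DifferentialClosure.coeffVector_translate f μ t)).symm
  rw [show (fun ν => coeffVector (degLEMonomials n) f ν + if ν = μ then t else 0) =
      coeffVector (degLEMonomials n) (f + monomial (μ : Fin n →₀ ℕ) t) from h]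
  obtain ⟨hdeg, hsize⟩ := translate_mem_deg hf hL μ hμ t
  exact hE _ hdeg hsize

/-- **Top piece, `(d+1)`-rung.** [folklore] -/
theorem iterate_pderiv_vanishes_deg {n s d : ℕ} {E : MvPolynomial ↥(degLEMonomials n) ℂ}
    (hE : ∀ g : MvPolynomial (Fin n) ℂ, g.totalDegree ≤ n → complexity g ≤ s + (d + 1) →
      eval (coeffVector (degLEMonomials n) g) E = 0)
    (μ : ↥(degLEMonomials n)) (hμ : (μ : Fin n →₀ ℕ).degree ≤ d) (j : ℕ)
    (f : MvPolynomial (Fin n) ℂ) (hf : f.totalDegree ≤ n) (hL : complexity f ≤ s) :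
    eval (coeffVector (degLEMonomials n) f) ((pderiv μ)^[j] E) = 0 :=
  iterate_pderiv_eval_eq_zero_of_line E _ μ (line_subset_zeros_deg hE hf hL μ hμ) j

/-- **Bottom piece, `(d+1)`-rung.** [folklore] -/
theorem killVar_iterate_pderiv_vanishes_deg {n s d : ℕ} {E : MvPolynomial ↥(degLEMonomials n) ℂ}
    (hE : ∀ g : MvPolynomial (Fin n) ℂ, g.totalDegree ≤ n → complexity g ≤ s + (d + 1) →
      eval (coeffVector (degLEMonomials n) g) E = 0)
    (μ : ↥(degLEMonomials n)) (hμ : (μ : Fin n →₀ ℕ).degree ≤ d) (j : ℕ)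
    (f : MvPolynomial (Fin n) ℂ) (hf : f.totalDegree ≤ n) (hL : complexity f ≤ s) :
    eval (coeffVector (degLEMonomials n) f)
      (aeval (fun ν => if ν = μ then (0 : MvPolynomial ↥(degLEMonomials n) ℂ) else X ν)
        ((pderiv μ)^[j] E)) = 0 := by
  rw [eval_killVar]
  have hpt : (fun ν => if ν = μ then (0 : ℂ) else coeffVector (degLEMonomials n) f ν) =
      fun ν => coeffVector (degLEMonomials n) f ν +
        if ν = μ then -coeffVector (degLEMonomials n) f μ else 0 := by
    funext ν; split_ifs with h
    · subst h; ring
    · ring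
  rw [hpt]
  exact iterate_pderiv_eval_line_eq_zero E _ μ (line_subset_zeros_deg hE hf hL μ hμ) j _

/-! ## §3 The invariant: all monomials involve only coordinates of degree `≤ d` -/

/-- The top pieces keep the invariant. [folklore] -/
theorem supportDeg_iterate_pderiv {n d : ℕ} {E : MvPolynomial ↥(degLEMonomials n) ℂ}
    (hd : ∀ m ∈ E.support, ∀ ν, m ν ≠ 0 → ((ν : ↥(degLEMonomials n)) : Fin n →₀ ℕ).degree ≤ d)
    (μ : ↥(degLEMonomials n)) (j : ℕ) :
    ∀ m ∈ ((pderiv μ)^[j] E).support, ∀ ν, m ν ≠ 0 →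
      ((ν : ↥(degLEMonomials n)) : Fin n →₀ ℕ).degree ≤ d := by
  intro m hm ν hν
  refine hd _ (add_single_mem_support_of_mem_support_iterate_pderiv μ hm) ν ?_
  simp only [Finsupp.coe_add, Pi.add_apply]
  omega

/-- The bottom pieces keep the invariant. [folklore] -/
theorem supportDeg_killVar_iterate_pderiv {n d : ℕ} {E : MvPolynomial ↥(degLEMonomials n) ℂ}
    (hd : ∀ m ∈ E.support, ∀ ν, m ν ≠ 0 → ((ν : ↥(degLEMonomials n)) : Fin n →₀ ℕ).degree ≤ d)
    (μ : ↥(degLEMonomials n)) (j : ℕ) :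
    ∀ m ∈ (aeval (fun ν => if ν = μ then (0 : MvPolynomial ↥(degLEMonomials n) ℂ) else X ν)
        ((pderiv μ)^[j] E)).support, ∀ ν, m ν ≠ 0 →
      ((ν : ↥(degLEMonomials n)) : Fin n →₀ ℕ).degree ≤ d := by
  classical
  intro m hm ν hν
  refine hd _ (mem_support_bottom μ hm).2 ν ?_
  simp only [Finsupp.coe_add, Pi.add_apply]
  omega

/-- A coordinate that actually occurs (positive partial degree) has degree `≤ d`. [folklore] -/
theorem degree_le_of_degreeOf_pos {n d : ℕ} {E : MvPolynomial ↥(degLEMonomials n) ℂ}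
    (hd : ∀ m ∈ E.support, ∀ ν, m ν ≠ 0 → ((ν : ↥(degLEMonomials n)) : Fin n →₀ ℕ).degree ≤ d)
    {μ : ↥(degLEMonomials n)} (hμ : 0 < degreeOf μ E) : (μ : Fin n →₀ ℕ).degree ≤ d := by
  classical
  by_contra hcon
  have h0 : degreeOf μ E ≤ 0 := by
    rw [degreeOf_eq_sup]
    refine Finset.sup_le fun m hm => ?_
    by_contra hne
    exact hcon (hd m hm μ (by omega))
  omega

/-! ## §4 The recursion: each `(d+1)`-rung of size doubles the number of monomials -/

/-- **Sparsity wall for equations on degree-`≤ d` coordinates.** A nonzero polynomial in the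
`C(2n,n)` coefficient variables all of whose monomials involve only coordinates `c_ν` with
`|ν| ≤ d`, vanishing at `coeff(g)` for every `g` of degree `≤ n` and size `≤ s`, where
`2n + 1 + r(d+1) ≤ s`, has at least `2^(r+1)` monomials. [folklore] -/
theorem card_support_ge_two_pow_deg {n d : ℕ} (r : ℕ) :
    ∀ {s : ℕ} {E : MvPolynomial ↥(degLEMonomials n) ℂ}, 2 * n + 1 + r * (d + 1) ≤ s → E ≠ 0 →
      (∀ m ∈ E.support, ∀ ν, m ν ≠ 0 → ((ν : ↥(degLEMonomials n)) : Fin n →₀ ℕ).degree ≤ d) →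
      (∀ g : MvPolynomial (Fin n) ℂ, g.totalDegree ≤ n → complexity g ≤ s →
        eval (coeffVector (degLEMonomials n) g) E = 0) →
      2 ^ (r + 1) ≤ E.support.card := by
  classical
  induction r with
  | zero =>
    intro s E hs hE0 _ hE
    exact two_le_card_support (by simpa using hs) hE0 hE
  | succ r ih =>
    intro s E hs hE0 hd hE
    obtain ⟨s', rfl⟩ : ∃ s', s = s' + (d + 1) := ⟨s - (d + 1), by
      have : d + 1 ≤ s := by nlinarith
      omega⟩
    have hs' : 2 * n + 1 + r * (d + 1) ≤ s' := by nlinarith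
    have h2 : 2 ≤ E.support.card := two_le_card_support (by omega) hE0 hE
    obtain ⟨μ, m₁, hm₁, hmin, hlt⟩ := exists_splitting_coordinate h2
    have hμ : (μ : Fin n →₀ ℕ).degree ≤ d := degree_le_of_degreeOf_pos hd (by omega)
    have htop := ih hs' (top_ne_zero μ hE0) (supportDeg_iterate_pderiv hd μ _)
      (fun g hg hgL => iterate_pderiv_vanishes_deg hE μ hμ _ g hg hgL)
    have hbot := ih hs' (bottom_ne_zero μ hm₁ hmin) (supportDeg_killVar_iterate_pderiv hd μ _)
      (fun g hg hgL => killVar_iterate_pderiv_vanishes_deg hE μ hμ _ g hg hgL)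
    have hpieces := card_support_pieces_le μ E hlt
    calc 2 ^ (r + 1 + 1) = 2 ^ (r + 1) + 2 ^ (r + 1) := by ring
      _ ≤ _ := (Nat.add_le_add htop hbot).trans hpieces

/-! ## §5 Window forms -/

/-- The pullback of a window polynomial involves only degree-`d` coordinates. [folklore] -/
theorem supportDeg_rename_inclusion {n d : ℕ} (h : d ≤ n)
    (E : MvPolynomial (GKSS2017.homMonomials n d) ℂ) :
    ∀ m ∈ (rename (Set.inclusion (homMonomials_subset_degLE h)) E).support, ∀ ν, m ν ≠ 0 →
      ((ν : ↥(degLEMonomials n)) : Fin n →₀ ℕ).degree ≤ d := by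
  classical
  intro m hm ν hν
  rw [support_rename_of_injective (Set.inclusion_injective _)] at hm
  obtain ⟨m', -, rfl⟩ := Finset.mem_image.1 hm
  by_contra hcon
  apply hν
  rw [Finsupp.mapDomain_notin_range]
  rintro ⟨μ, rfl⟩
  exact hcon (le_of_eq μ.2)

/-- The pullback of a window polynomial has the same number of monomials. [folklore] -/
theorem card_support_rename_inclusion {n d : ℕ} (h : d ≤ n)
    (E : MvPolynomial (GKSS2017.homMonomials n d) ℂ) :
    (rename (Set.inclusion (homMonomials_subset_degLE h)) E).support.card = E.support.card := by
  classical
  rw [support_rename_of_injective (Set.inclusion_injective _),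
    Finset.card_image_of_injective _ (Finsupp.mapDomain_injective (Set.inclusion_injective _))]

/-- **Sparsity wall in the degree-`d` window.** A nonzero polynomial in the `C(n+d-1,d)` degree-`d`
coefficient variables (`d ≤ n`) vanishing at `coeff_d(g)` for every `g` of degree `≤ n` and size
`≤ s`, `2n + 1 + r(d+1) ≤ s`, has at least `2^(r+1)` monomials. [folklore] -/
theorem card_support_ge_two_pow_window {n d r s : ℕ} (hd : d ≤ n) (hs : 2 * n + 1 + r * (d + 1) ≤ s)
    {E : MvPolynomial (GKSS2017.homMonomials n d) ℂ} (hE0 : E ≠ 0)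
    (hE : ∀ g : MvPolynomial (Fin n) ℂ, g.totalDegree ≤ n → complexity g ≤ s →
      eval (coeffVector (GKSS2017.homMonomials n d) g) E = 0) :
    2 ^ (r + 1) ≤ E.support.card := by
  rw [← card_support_rename_inclusion hd E]
  exact card_support_ge_two_pow_deg r hs (rename_inclusion_ne_zero hd hE0)
    (supportDeg_rename_inclusion hd E)
    (fun g hg hgL => by rw [eval_rename_inclusion hd]; exact hE g hg hgL)

/-- **At the crux**: if `2n + 1 + r(d+1) ≤ n^b` (`d ≤ n`) then every nonzero degree-`d` window
equation for `SmallCircuits ℂ n b` has at least `2^(r+1)` monomials. [folklore] -/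
theorem card_support_ge_two_pow_window_smallCircuits {n b d r : ℕ} (hd : d ≤ n)
    (hr : 2 * n + 1 + r * (d + 1) ≤ n ^ b)
    {E : MvPolynomial (GKSS2017.homMonomials n d) ℂ} (hE0 : E ≠ 0)
    (hE : ∀ f ∈ SmallCircuits ℂ n b, eval (coeffVector (GKSS2017.homMonomials n d) f) E = 0) :
    2 ^ (r + 1) ≤ E.support.card :=
  card_support_ge_two_pow_window hd hr hE0 fun g hg hgL => hE g ⟨hg, hgL⟩

/-- **The cubic window at the open rung `b = 2`** (`n ≥ 3`): every nonzero polynomial in the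
`C(n+2,3)` cubic coefficient variables vanishing on `coeff_3(SmallCircuits ℂ n 2)` has at least
`2^((n² - 2n - 1)/4 + 1)` monomials — super-polynomial in `N = C(2n,n) ≤ 4^n`. [folklore] -/
theorem cubicWindow_card_support_two {n : ℕ} (hn : 3 ≤ n)
    {E : MvPolynomial (GKSS2017.homMonomials n 3) ℂ} (hE0 : E ≠ 0)
    (hE : ∀ f ∈ SmallCircuits ℂ n 2, eval (coeffVector (GKSS2017.homMonomials n 3) f) E = 0) :
    2 ^ ((n ^ 2 - 2 * n - 1) / 4 + 1) ≤ E.support.card := by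
  refine card_support_ge_two_pow_window_smallCircuits hn ?_ hE0 hE
  have h1 : 2 * n + 1 ≤ n ^ 2 := by nlinarith
  have h2 := Nat.div_mul_le_self (n ^ 2 - 2 * n - 1) 4
  omega

/-- **Window witnesses at `b = 2` are never `N^a`-sparse, with an explicit threshold**: for
`d ≤ n` and `n ≥ 2a(d+1) + 3`, every nonzero degree-`d` window equation for `SmallCircuits ℂ n 2`
has MORE than `N^a = C(2n,n)^a` monomials. [cite: ForbesShpilkaVolk2018, Cor. 34] -/
theorem pow_lt_card_support_window_two {n a d : ℕ} (hd : d ≤ n) (hn : 2 * a * (d + 1) + 3 ≤ n)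
    {E : MvPolynomial (GKSS2017.homMonomials n d) ℂ} (hE0 : E ≠ 0)
    (hE : ∀ f ∈ SmallCircuits ℂ n 2, eval (coeffVector (GKSS2017.homMonomials n d) f) E = 0) :
    (Nat.choose (2 * n) n) ^ a < E.support.card := by
  -- `r = 2an` rungs of cost `d + 1` fit below `n²`
  have hr : 2 * n + 1 + (2 * a * n) * (d + 1) ≤ n ^ 2 := by
    have h1 : 2 * a * (d + 1) + 3 ≤ n := hn
    have h2 : (2 * a * (d + 1) + 3) * n ≤ n * n := Nat.mul_le_mul_right n h1
    nlinarith
  have hcard := card_support_ge_two_pow_window_smallCircuits hd hr hE0 hE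
  calc (Nat.choose (2 * n) n) ^ a ≤ (2 ^ (2 * n)) ^ a :=
        Nat.pow_le_pow_left (Nat.choose_le_two_pow _ _) a
    _ = 2 ^ (2 * a * n) := by rw [← pow_mul]; ring_nf
    _ < 2 ^ (2 * a * n + 1) := Nat.pow_lt_pow_right (by norm_num) (by omega)
    _ ≤ E.support.card := hcard

/-- **Hitting form**: for `d ≤ n` and `n ≥ 2a(d+1) + 3`, the degree-`d` coefficient vectors of
`SmallCircuits ℂ n 2` hit every nonzero polynomial in the degree-`d` window variables with at most
`N^a` monomials (any degree, any circuit size). [cite: ForbesShpilkaVolk2018, Def. 3 / Cor. 34] -/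
theorem isSuccinctHittingSet_window_sparse_two {n a d : ℕ} (hd : d ≤ n)
    (hn : 2 * a * (d + 1) + 3 ≤ n) :
    IsSuccinctHittingSet (GKSS2017.homMonomials n d) (SmallCircuits ℂ n 2)
      {D : MvPolynomial (GKSS2017.homMonomials n d) ℂ | D.support.card ≤ (Nat.choose (2 * n) n) ^ a} := by
  intro D hD hD0
  by_contra hcon
  push Not at hcon
  exact absurd hD (not_le.mpr (pow_lt_card_support_window_two hd hn hD0 hcon))


/-! ## §6 (appended by the same seat) The SUPPORT WALL in the window: every monomial of a
## degree-`d` window equation for size `s` involves `> s/(d+1)` distinct coordinates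

A `t`-sparse degree-`d` form `Σ_{μ ∈ S} v_μ x^μ` (`#S ≤ t`, `|μ| = d ≤ n`) costs `≤ t (d + 1)` gates
(`L(v_μ x^μ) ≤ |μ| = d`), so for `t (d+1) ≤ s` every point of the window supported on `≤ t`
coordinates is `coeff_d` of a member of the class; by
`DegreeLowerBound.lt_card_support_of_eval_eq_zero` every monomial of a window equation involves
`> t` distinct window variables, and the equation has total degree `> t`.  At the open rung
`b = 2`, `d = 3`: every monomial of a cubic window equation touches more than `⌊n²/4⌋` of the
`C(n+2,3)` cubic coefficients, and the equation has total degree `> ⌊n²/4⌋`. -/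

/-- A `t`-sparse degree-`d` form (`#S ≤ t`, `d ≤ n`) has degree `≤ n`, costs `≤ t (d + 1)` gates,
and its window coefficient vector is the prescribed one. [cite: Burgisser2000, §2.1] -/
theorem sparseForm_mem_of_card_le {n d t : ℕ} (hd : d ≤ n) (S : Finset (GKSS2017.homMonomials n d))
    (hS : S.card ≤ t) (v : GKSS2017.homMonomials n d → ℂ) (hv : ∀ μ, μ ∉ S → v μ = 0) :
    (∑ μ ∈ S, monomial (μ : Fin n →₀ ℕ) (v μ) : MvPolynomial (Fin n) ℂ).totalDegree ≤ n ∧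
      complexity (∑ μ ∈ S, monomial (μ : Fin n →₀ ℕ) (v μ) : MvPolynomial (Fin n) ℂ) ≤ t * (d + 1) ∧
      coeffVector (GKSS2017.homMonomials n d)
        (∑ μ ∈ S, monomial (μ : Fin n →₀ ℕ) (v μ) : MvPolynomial (Fin n) ℂ) = v := by
  classical
  have hdeg : ∀ μ : GKSS2017.homMonomials n d, (μ : Fin n →₀ ℕ).degree = d := fun μ => μ.2
  refine ⟨(totalDegree_finsetSum _ _).trans (Finset.sup_le fun μ _ => ?_), ?_, ?_⟩
  · refine (totalDegree_monomial_le _ _).trans ?_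
    have h : ((μ : Fin n →₀ ℕ).sum fun _ => id) = (μ : Fin n →₀ ℕ).degree := by
      rw [Finsupp.degree_apply]; rfl
    rw [h, hdeg μ]
    exact hd
  · refine (complexity_finset_sum_le _ _).trans ?_
    have h1 : ∑ μ ∈ S, complexity (monomial (μ : Fin n →₀ ℕ) (v μ) : MvPolynomial (Fin n) ℂ) ≤
        ∑ _μ ∈ S, d :=
      Finset.sum_le_sum fun μ _ => (complexity_monomial_le_degree _ _).trans (hdeg μ).le
    rw [Finset.sum_const, smul_eq_mul] at h1
    calc ∑ μ ∈ S, complexity (monomial (μ : Fin n →₀ ℕ) (v μ) : MvPolynomial (Fin n) ℂ) + S.card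
        ≤ S.card * d + S.card := Nat.add_le_add_right h1 _
      _ = S.card * (d + 1) := by ring
      _ ≤ t * (d + 1) := Nat.mul_le_mul_right _ hS
  · funext ν
    rw [coeffVector_apply, coeff_sum]
    by_cases hν : ν ∈ S
    · rw [Finset.sum_eq_single_of_mem ν hν]
      · rw [coeff_monomial, if_pos rfl]
      · intro μ _ hμν
        rw [coeff_monomial, if_neg]
        exact fun h => hμν (Subtype.ext h)
    · rw [hv ν hν]
      refine Finset.sum_eq_zero fun μ hμ => ?_
      rw [coeff_monomial, if_neg]
      exact fun h => hν ((Subtype.ext h : μ = ν) ▸ hμ)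

/-- **Support wall in the degree-`d` window.** If a window polynomial `E` vanishes at `coeff_d(g)`
for every `g` of degree `≤ n` and size `≤ s`, and `t (d + 1) ≤ s` (`d ≤ n`), then every monomial of
`E` involves more than `t` distinct window variables. [folklore] -/
theorem lt_card_support_window_of_vanishes {n d s t : ℕ} (hd : d ≤ n) (hts : t * (d + 1) ≤ s)
    {E : MvPolynomial (GKSS2017.homMonomials n d) ℂ}
    (hE : ∀ g : MvPolynomial (Fin n) ℂ, g.totalDegree ≤ n → complexity g ≤ s →
      eval (coeffVector (GKSS2017.homMonomials n d) g) E = 0)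
    {m : GKSS2017.homMonomials n d →₀ ℕ} (hm : m ∈ E.support) : t < m.support.card := by
  classical
  refine DegreeLowerBound.lt_card_support_of_eval_eq_zero (fun S hS v hv => ?_) hm
  obtain ⟨hdeg, hsize, hcv⟩ := sparseForm_mem_of_card_le hd S hS v hv
  rw [← hcv]
  exact hE _ hdeg (hsize.trans hts)

/-- … and hence such an `E ≠ 0` has total degree `> t`. [folklore] -/
theorem lt_totalDegree_window_of_vanishes {n d s t : ℕ} (hd : d ≤ n) (hts : t * (d + 1) ≤ s)
    {E : MvPolynomial (GKSS2017.homMonomials n d) ℂ} (hE0 : E ≠ 0)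
    (hE : ∀ g : MvPolynomial (Fin n) ℂ, g.totalDegree ≤ n → complexity g ≤ s →
      eval (coeffVector (GKSS2017.homMonomials n d) g) E = 0) :
    t < E.totalDegree := by
  classical
  obtain ⟨m, hm⟩ : ∃ m, m ∈ E.support := by
    by_contra hno
    push Not at hno
    exact hE0 (MvPolynomial.support_eq_empty.mp (Finset.eq_empty_of_forall_notMem hno))
  refine (lt_card_support_window_of_vanishes hd hts hE hm).trans_le
    (le_trans ?_ (MvPolynomial.le_totalDegree hm))
  calc m.support.card = ∑ i ∈ m.support, 1 := by simp
    _ ≤ m.sum fun _ e => e := by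
        unfold Finsupp.sum
        exact Finset.sum_le_sum fun i hi => Nat.one_le_iff_ne_zero.mpr (Finsupp.mem_support_iff.mp hi)

/-- **The cubic window at `b = 2`**: every monomial of a cubic window equation for
`SmallCircuits ℂ n 2` (`n ≥ 3`) involves more than `⌊n²/4⌋` distinct cubic coefficients, and the
equation has total degree `> ⌊n²/4⌋`. [folklore] -/
theorem cubicWindow_support_two {n : ℕ} (hn : 3 ≤ n)
    {E : MvPolynomial (GKSS2017.homMonomials n 3) ℂ} (hE0 : E ≠ 0)
    (hE : ∀ f ∈ SmallCircuits ℂ n 2, eval (coeffVector (GKSS2017.homMonomials n 3) f) E = 0) :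
    (∀ m ∈ E.support, n ^ 2 / 4 < m.support.card) ∧ n ^ 2 / 4 < E.totalDegree := by
  have hts : n ^ 2 / 4 * (3 + 1) ≤ n ^ 2 := by
    have := Nat.div_mul_le_self (n ^ 2) 4
    omega
  exact ⟨fun m hm => lt_card_support_window_of_vanishes hn hts (fun g hg hgL => hE g ⟨hg, hgL⟩) hm,
    lt_totalDegree_window_of_vanishes hn hts hE0 fun g hg hgL => hE g ⟨hg, hgL⟩⟩

end DegreeWindow

end Summit.ValiantsHypothesis.ValiantsHypothesis.Theorems.BarrierLeverDefinableEquations
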